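import Summits.ResolutionOfSingularities.ResolutionOfSingularities.Theorems.RadicialJungCleanModelsF75cRegularPieces
import Literature.AlgebraicGeometry.Resolution.NormalCrossingsLocal
import HarnessLib

/-!
# [F-75c discharge, brick N2] Principalization over one integral open-and-closed piece of a regular surface by
# blowing up closed points of the ambient scheme (The Stacks Project, Lemma 54.4.1 = Tag 0AHH, non-integral ambient)

Cell res-hironaka, D-0154 INPUTS discharger `res-inputs-p-f75c` for the named fact F-75c
`Literature.AlgebraicGeometry.Resolution.Stacks0BIC_embeddedResolutionCurvesInSurfaces_locus`
(`--supports stmt-ResolutionOfSingularities-15917 --as helper`). F-75c's `X` is not assumed integral; brick P3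
(`exists_isPointBlowupComposition_isLocallyPrincipal`) is. Here the ambient scheme `X` is Noetherian with regular
local rings, excellent, of dimension `≤ 2`, and `U ⊆ X` is an open AND closed INTEGRAL piece (an irreducible component,
brick N1). **`exists_isPointBlowupComposition_isLocallyPrincipalAt_over`**: blowing up closed points OF `X` lying in
`U ∩ NP(I)` makes `I·𝒪` locally principal at every point over `U`. Proof: induction on the measure of brick P2 for the
integral scheme `U` and `I|_U`; one blowing up `π` of `X` at `x ∈ U` restricts over `U` to the blowing up of `U` at `x`
(`IsBlowup.restrict`), to which `F75c.measure_comap_lt` applies verbatim, `π⁻¹U` being again an integral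
open-and-closed piece of the blown-up scheme.

HONEST FRAMING: bookkeeping over this seat's bricks P2/P3/N1 and tree theorems; nothing here is a statement of
[Hironaka2017]. AI-written; AI review is weaker than expert review. References: The Stacks Project, Tags 0AHH, 0BIB [StacksProject].
-/

noncomputable section

set_option linter.dupNamespace false -- mandated namespace of this single-conjunct summit

open CategoryTheory AlgebraicGeometry TopologicalSpace IsLocalRing

namespace Summit.ResolutionOfSingularities.ResolutionOfSingularities.Theorems

namespace F75c

open Literature.AlgebraicGeometry.Resolution
open Summit.ResolutionOfSingularities.ResolutionOfSingularities.Theorems.CampaignW46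
open Scheme.IdealSheafData

universe u

/-- The open subscheme on an open subset of a Noetherian regular excellent scheme of dimension `≤ 2` is Noetherian,
regular, excellent, of dimension `≤ 2`. [folklore] -/
theorem opens_invariants {X : Scheme.{u}} [IsNoetherian X] (hreg : Scheme.IsRegular X) (hexc : Scheme.IsExcellent X)
    (hdim : topologicalKrullDim X ≤ 2) (U : X.Opens) :
    IsNoetherian (U : Scheme.{u}) ∧ Scheme.IsRegular (U : Scheme.{u}) ∧ Scheme.IsExcellent (U : Scheme.{u}) ∧
      topologicalKrullDim (U : Scheme.{u}) ≤ 2 := by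
  haveI : IsLocallyNoetherian (U : Scheme.{u}) := isLocallyNoetherian_of_isOpenImmersion U.ι
  haveI : NoetherianSpace (U : Scheme.{u}) := inferInstanceAs (NoetherianSpace (U : Set X))
  haveI : CompactSpace (U : Scheme.{u}) := inferInstance
  exact ⟨{}, hreg.of_isOpenImmersion U.ι, hexc.of_isOpenImmersion U.ι,
    (topologicalKrullDim_subspace_le X (U : Set X)).trans hdim⟩

/-- **Principalization over an integral open-and-closed piece** (Stacks Tag 0AHH with a non-integral ambient scheme):
for `X` Noetherian, regular, excellent, `dim ≤ 2`, an open and closed `U ⊆ X` which is integral as a scheme, and an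
ideal sheaf `I`, there is a composition `π : X' → X` of blowing ups at closed points lying in `U ∩ NP(I)` such that
`I·𝒪_{X'}` is locally principal at every point over `U`. [cite: StacksProject, Tag 0AHH (Lemma 54.4.1)]
[cite: StacksProject, Tag 0BIB (Lemma 54.15.5)] -/
theorem exists_isPointBlowupComposition_isLocallyPrincipalAt_over (X : Scheme.{u}) [IsNoetherian X]
    (hreg : Scheme.IsRegular X) (hexc : Scheme.IsExcellent X) (hdim : topologicalKrullDim X ≤ 2) (U : X.Opens)
    (hUcl : IsClosed (U : Set X)) (hUint : IsIntegral (U : Scheme.{u})) (I : X.IdealSheafData) :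
    ∃ (X' : Scheme.{u}) (π : X' ⟶ X), IsPointBlowupComposition ((nonPrincipalLocus I : Set X) ∩ (U : Set X)) π ∧
      ∀ x' : X', π x' ∈ (U : Set X) → IsLocallyPrincipalAt (I.comap π) x' := by
  classical
  -- the measure of brick P2 on the integral piece
  suffices H : ∀ (n : ℕ) (Y : Scheme.{u}) [IsNoetherian Y], Scheme.IsRegular Y → Scheme.IsExcellent Y →
      topologicalKrullDim Y ≤ 2 → ∀ (V : Y.Opens), IsClosed (V : Set Y) → ∀ [IsIntegral (V : Scheme.{u})]
      (J : Y.IdealSheafData) (hN : (nonPrincipalLocus (J.comap V.ι) : Set (V : Scheme.{u})).Finite),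
      ∑ v ∈ hN.toFinset, (idealBaseTree (algebraMap ((V : Scheme.{u}).presheaf.stalk v) (V : Scheme.{u}).functionField).range
        ((stalkIdeal (J.comap V.ι) v).map
          (algebraMap ((V : Scheme.{u}).presheaf.stalk v) (V : Scheme.{u}).functionField).rangeRestrict)).ncard ≤ n →
      ∃ (Y' : Scheme.{u}) (π : Y' ⟶ Y), IsPointBlowupComposition ((nonPrincipalLocus J : Set Y) ∩ (V : Set Y)) π ∧
        ∀ y' : Y', π y' ∈ (V : Set Y) → IsLocallyPrincipalAt (J.comap π) y' by
    haveI := hUint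
    obtain ⟨hNU, hregU, -, hdimU⟩ := opens_invariants hreg hexc hdim U
    haveI := hNU
    exact H _ X hreg hexc hdim U hUcl I (finite_nonPrincipalLocus hregU hdimU _).1 le_rfl
  intro n
  induction n with
  | zero =>
    intro Y _ hreg hexc hdim V hVcl _ J hN hle
    obtain ⟨hNV, hregV, -, hdimV⟩ := opens_invariants hreg hexc hdim V
    haveI := hNV
    -- measure `0`: no non-principal point over `V`
    have hempty : (nonPrincipalLocus (J.comap V.ι) : Set (V : Scheme.{u})) = ∅ := by
      by_contra hne
      obtain ⟨v, hv⟩ := Set.nonempty_iff_ne_empty.mpr hne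
      have hv2 := ((finite_nonPrincipalLocus hregV hdimV (J.comap V.ι)).2 v hv).2
      haveI := hregV v
      haveI := isLocalRing_range_algebraMap_stalk (Z := (V : Scheme.{u})) v
      haveI : IsRegularLocalRing (algebraMap ((V : Scheme.{u}).presheaf.stalk v) (V : Scheme.{u}).functionField).range :=
        isRegularLocalRing_range_of v
      have hR2 : ringKrullDim (algebraMap ((V : Scheme.{u}).presheaf.stalk v) (V : Scheme.{u}).functionField).range = 2 := by
        rw [ringKrullDim_range_algebraMap_stalk]; exact hv2
      have hvJ : ¬ (stalkIdeal (J.comap V.ι) v).IsPrincipal := by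
        have h := hv
        rw [coe_nonPrincipalLocus_eq_setOf_not_isPrincipal] at h
        exact h
      have h1 := one_le_ncard_idealBaseTree
        (fun h => hvJ ((isPrincipal_stalkIdeal_iff (J.comap V.ι) v).mp h))
        (finite_idealBaseTree_of_isRegularLocalRing _ hR2 (isLocalRingOf_range_algebraMap_stalk v) _)
      have hvN : v ∈ hN.toFinset := by rw [Set.Finite.mem_toFinset]; exact hv
      have := Finset.single_le_sum (f := fun w => (idealBaseTree
        (algebraMap ((V : Scheme.{u}).presheaf.stalk w) (V : Scheme.{u}).functionField).range
        ((stalkIdeal (J.comap V.ι) w).map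
          (algebraMap ((V : Scheme.{u}).presheaf.stalk w) (V : Scheme.{u}).functionField).rangeRestrict)).ncard)
        (fun w _ => Nat.zero_le _) hvN
      omega
    refine ⟨Y, 𝟙 Y, IsPointBlowupComposition.nil, fun y' hy' => ?_⟩
    rw [Scheme.IdealSheafData.comap_id]
    by_contra hnp
    have hmem : (⟨y', hy'⟩ : (V : Scheme.{u})) ∈ (nonPrincipalLocus (J.comap V.ι) : Set (V : Scheme.{u})) := by
      rw [coe_nonPrincipalLocus_comap_of_isOpenImmersion]; exact hnp
    rw [hempty] at hmem
    exact hmem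
  | succ n ih =>
    intro Y _ hreg hexc hdim V hVcl _ J hN hle
    obtain ⟨hNV, hregV, hexcV, hdimV⟩ := opens_invariants hreg hexc hdim V
    haveI := hNV
    by_cases hempty : (nonPrincipalLocus (J.comap V.ι) : Set (V : Scheme.{u})) = ∅
    · refine ⟨Y, 𝟙 Y, IsPointBlowupComposition.nil, fun y' hy' => ?_⟩
      rw [Scheme.IdealSheafData.comap_id]
      by_contra hnp
      have hmem : (⟨y', hy'⟩ : (V : Scheme.{u})) ∈ (nonPrincipalLocus (J.comap V.ι) : Set (V : Scheme.{u})) := by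
        rw [coe_nonPrincipalLocus_comap_of_isOpenImmersion]; exact hnp
      rw [hempty] at hmem
      exact hmem
    -- a non-principal point `v` of `J|_V`, closed with two-dimensional regular local ring
    obtain ⟨v, hv⟩ := Set.nonempty_iff_ne_empty.mpr hempty
    obtain ⟨hvcl, hv2⟩ := (finite_nonPrincipalLocus hregV hdimV (J.comap V.ι)).2 v hv
    haveI := hregV v
    -- the point `x = v` of `Y`: closed, in `V ∩ NP(J)`
    have hxNP : v.1 ∈ (nonPrincipalLocus J : Set Y) ∩ (V : Set Y) := by
      refine ⟨?_, v.2⟩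
      have h := hv
      rw [coe_nonPrincipalLocus_comap_of_isOpenImmersion] at h
      exact h
    have hxcl : IsClosed ({v.1} : Set Y) := ((finite_nonPrincipalLocus hreg hdim J).2 v.1 hxNP.1).1
    -- `J|_V ≠ 0`, so the generic point of `V` is not a non-principal point; in particular `v` is not generic
    have hJV : J.comap V.ι ≠ ⊥ := by
      intro h0
      have h := hv
      rw [coe_nonPrincipalLocus_eq_setOf_not_isPrincipal, Set.mem_setOf_eq, h0, stalkIdeal_bot] at h
      exact h ⟨⟨0, by simp⟩⟩
    have hvgen : genericPoint (V : Scheme.{u}) ≠ v := fun h =>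
      genericPoint_not_mem_nonPrincipalLocus hJV (h ▸ hv)
    have hxne : ({v.1} : Set Y) ≠ Set.univ := by
      intro h
      have hη : (genericPoint (V : Scheme.{u})).1 ∈ ({v.1} : Set Y) := h ▸ Set.mem_univ _
      rw [Set.mem_singleton_iff] at hη
      exact hvgen (Subtype.ext hη)
    have hvne : ({v} : Set (V : Scheme.{u})) ≠ Set.univ := by
      intro h
      have hη : genericPoint (V : Scheme.{u}) ∈ ({v} : Set (V : Scheme.{u})) := h ▸ Set.mem_univ _
      rw [Set.mem_singleton_iff] at hη
      exact hvgen hη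
    -- blow up `Y` at `v`
    obtain ⟨Y₁, π₁, hπ₁⟩ := exists_isBlowup Y (vanishingIdeal ⟨{v.1}, hxcl⟩)
    have h₁ : IsPointBlowupComposition ((nonPrincipalLocus J : Set Y) ∩ (V : Set Y)) π₁ :=
      IsPointBlowupComposition.single π₁ v.1 hxcl hxne hxNP hπ₁
    obtain ⟨hN₁, hreg₁, hexc₁, hdim₁⟩ := IsPointBlowupComposition.invariants h₁ hreg hexc hdim
    haveI := hN₁
    -- the piece upstairs: `V₁ = π₁⁻¹ V`, open and closed; the restricted blowing up
    set V₁ : Y₁.Opens := π₁ ⁻¹ᵁ V with hV₁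
    have hV₁cl : IsClosed (V₁ : Set Y₁) := hVcl.preimage π₁.continuous
    have hres : IsBlowup (π₁ ∣_ V) (vanishingIdeal ⟨{v}, hvcl⟩) := by
      have h := hπ₁.restrict V
      rw [comap_vanishingIdeal_of_isOpenImmersion] at h
      have hpre : (⟨{v.1}, hxcl⟩ : Closeds Y).preimage V.ι.continuous = ⟨{v}, hvcl⟩ := by
        ext w
        change V.ι w ∈ ({v.1} : Set Y) ↔ w ∈ ({v} : Set (V : Scheme.{u}))
        rw [Set.mem_singleton_iff, Set.mem_singleton_iff, Scheme.Opens.ι_apply]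
        exact ⟨fun hw => Subtype.ext hw, fun hw => by rw [hw]⟩
      rwa [hpre] at h
    haveI : IsIntegral (V₁ : Scheme.{u}) := hres.isIntegral (vanishingIdeal_singleton_ne_bot hvcl hvne)
    obtain ⟨hNV₁, hregV₁, -, hdimV₁⟩ := opens_invariants hreg₁ hexc₁ hdim₁ V₁
    haveI := hNV₁
    -- the ideals upstairs: `(J|_V)·𝒪_{V₁} = (J·𝒪_{Y₁})|_{V₁}`
    have hI : (J.comap V.ι).comap (π₁ ∣_ V) = (J.comap π₁).comap V₁.ι := by
      rw [← Scheme.IdealSheafData.comap_comp, ← Scheme.IdealSheafData.comap_comp, morphismRestrict_ι]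
    -- the measure drops (brick P2 on the integral piece)
    have hfin₁ := (finite_nonPrincipalLocus hregV₁ hdimV₁ ((J.comap π₁).comap V₁.ι)).1
    have key : ∀ (K : (V₁ : Scheme.{u}).IdealSheafData) (hK : K = (J.comap V.ι).comap (π₁ ∣_ V))
        (hfin : (nonPrincipalLocus K : Set (V₁ : Scheme.{u})).Finite),
        ∑ w ∈ hfin.toFinset, (idealBaseTree
          (algebraMap ((V₁ : Scheme.{u}).presheaf.stalk w) (V₁ : Scheme.{u}).functionField).range
          ((stalkIdeal K w).map
            (algebraMap ((V₁ : Scheme.{u}).presheaf.stalk w) (V₁ : Scheme.{u}).functionField).rangeRestrict)).ncard <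
        ∑ w ∈ hN.toFinset, (idealBaseTree
          (algebraMap ((V : Scheme.{u}).presheaf.stalk w) (V : Scheme.{u}).functionField).range
          ((stalkIdeal (J.comap V.ι) w).map
            (algebraMap ((V : Scheme.{u}).presheaf.stalk w) (V : Scheme.{u}).functionField).rangeRestrict)).ncard := by
      rintro K rfl hfin
      exact measure_comap_lt hvcl hres hv2 (J.comap V.ι) hv hN hfin
    have hlt := key _ hI.symm hfin₁
    -- induction
    obtain ⟨Y', π', hπ', hlp⟩ := ih Y₁ hreg₁ hexc₁ hdim₁ V₁ hV₁cl (J.comap π₁) hfin₁ (by omega)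
    refine ⟨Y', π' ≫ π₁, h₁.comp ?_ hπ', fun y' hy' => ?_⟩
    · rintro _ ⟨y₁, ⟨hy₁, hy₁V⟩, rfl⟩
      exact ⟨nonPrincipalLocus_comap_subset π₁ J hy₁, hy₁V⟩
    · rw [Scheme.IdealSheafData.comap_comp]
      exact hlp y' (by rw [Scheme.Hom.comp_apply] at hy'; exact hy')

end F75c

end Summit.ResolutionOfSingularities.ResolutionOfSingularities.Theorems

end
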